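import Mathlib
import Literature.MathematicalPhysics.QuantumFieldTheory.Balaban1983to89.B9AdOrthogonal
import Summits.QuantumFields.BalabanUV.Beta.ThinLoopHolonomy

/-!
# Beta / AdjointCarrierWiring — THE CARRIER WIRING `Ad(U) ↔ real orthogonal component matrices`, part 1 (algebra +
# the Lipschitz bound): for a unitary `u ∈ U(N)` the component matrix `adMat c e u` of `R(u)X = uXu⁻¹` in a
# trace-orthonormal hermitian family `e` (pv27 `B9AdOrthogonal.compMat` at one bond) is ORTHOGONAL, MULTIPLICATIVE
# (`adMat (u·w) = adMat u · adMat w`, `adMat u⁻¹ = (adMat u)ᵀ`) and `‖cpx(adMat u) − 1‖_{ℓ²-op} ≤ 2·‖u − 1‖_{ℓ²-op}` —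
# the dictionary by which b07∕an4's `M_N(ℂ)`-valued transports enter the MODEL's `Matrix Cp Cp ℝ` ∕ `cpxHom` ∕ `hdef`
# currency with a factor `2` and nothing else (unit `b2b-balaban-beta-d4-p3`, GEN 8, road P3 «reduction road»; item
# «MINE (d)» journal l.17529 = the row-D4 owner's residue-(d) «carrier wiring» OFFER an4-g41 l.17408, spec (i)–(ii);
# part 2 `AdjointCarrierWiringEnd` does (iii)–(iv))

HONEST FRAMING: discharging `BetaPertH` makes Bałaban's UV stability UNCONDITIONAL — NOT the continuum limit, NOT the
Clay problem.  HONEST DEPENDENCY (verbatim): «continuum YM on T⁴ ⇐ BetaPertH ∧ nine spine estimates (0/9 proved);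
BetaPertH ⇐ (D1) ∧ (D4) ∧ CAP+tail; G-an2-4 gates asym, D1 and NE2/3/4.»  THIS MODULE DISCHARGES NOTHING of `BetaPertH`,
asserts NOTHING printed and cites nothing as a fact (ABSOLUTE RULE): [folklore] linear algebra (the adjoint representation
of `U(N)` in trace-orthonormal hermitian components; Hilbert–Schmidt vs `ℓ²`-operator norm) over pv27's
`B9AdOrthogonal` (`R`, `form`, `compMat`, `parseval`, `coord_map`, `compMat_orthogonal`, `compMat_inv` BY NAME).
[B9] = `Balaban1985BackgroundPropagators` (3.19) p. 393 «R(U(Γ^{(j)}_{y,x}))» and p. 392 (the trace form) are LOCATORS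
of the shapes only.  No class change on row D4 or G-B9-15 (readiness width 0; D4 DISCHARGE NO DATE); NOT BetaPertH,
NOT continuum, NOT Clay, NOT summit progress.

CONTENT (kernel, 0 sorry).  §1 `adMat c e u := (k, i) ↦ form c (e k) (R u (e i))` (= `compMat` at one bond):
`adMat_inv`∕`adMat_star`, `adMat_mul`, `adMat_one`, `adMat_transpose_mul_self`∕`adMat_mul_transpose_self` — over a
component family `e` that is `form c`-orthonormal and complete on a real subspace `P ∋ e_k` stable under `R(u)`, `u`
unitary.  §2 Hilbert–Schmidt bookkeeping (`fro M = Σ_{ab}|M_{ab}|² = Re tr(MMᴴ)`; left multiplication costs `‖A‖²_op`;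
right multiplication by a unitary and `ᴴ` cost nothing) ⟹ **`fro_R_sub_le`**: `fro (R u X − X) ≤ 4‖u − 1‖²·fro X`.
§3 Parseval turns this into the component statement: **`adMat_real_bound`** (`Σ_k (((adMat u) − 1)a)_k² ≤ 4‖u−1‖²·Σ_k a_k²`
for real `a`, `P ⊆` hermitian) and, through real and imaginary parts, **`norm_cpx_adMat_sub_one_le`**:
`‖cpx(adMat c e u) − 1‖ ≤ 2·‖u − 1‖` (both norms the `ℓ²`-operator norms of the cell, B7 (19)).  §4 non-vacuity:
su(2) in the Pauli components (pv27 §4), `u = σ₁`.  UNIVERSES: `n ι : Type` (the MODEL files downstream are stated over `Type`).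
-/

namespace Summit.QuantumFields.BalabanUV.Beta.AdjointCarrierWiring

open scoped BigOperators Matrix ComplexOrder Matrix.Norms.L2Operator
open Finset
open Literature.MathematicalPhysics.QuantumFieldTheory.Balaban1983to89.B9AdOrthogonal
open Literature.MathematicalPhysics.QuantumLattice (isUnit_det_of_mem_unitaryGroup)
open Summit.QuantumFields.BalabanUV.Beta.ThinLoopHolonomy (cpxHom cpxHom_apply norm_toLp_mulVec_le norm_le_of_mulVec_le)

noncomputable section

variable {n : Type} [Fintype n] [DecidableEq n] {ι : Type}

/-! ## §1 The single-matrix adjoint component map and its algebra -/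

section Def

/-- **The component matrix of `R(u) = Ad(u)`** in the family `e`: `(adMat c e u)_{ki} = e_k · R(u)e_i` (pv27's
`compMat c e U b` for the one-bond field `U _ = u`). [cite: Balaban1985BackgroundPropagators, (3.3) pp.390–391 + (3.19) p.393] -/
def adMat (c : ℝ) (e : ι → Matrix n n ℂ) (u : Matrix n n ℂ) : Matrix ι ι ℝ :=
  Matrix.of fun k i => form c (e k) (R u (e i))

/-- Unfolding equation. [folklore] -/
theorem adMat_apply (c : ℝ) (e : ι → Matrix n n ℂ) (u : Matrix n n ℂ) (k i : ι) :
    adMat c e u k i = form c (e k) (R u (e i)) := rfl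

/-- `adMat` IS pv27's `compMat` read at one bond. [folklore] -/
theorem adMat_eq_compMat {Bd : Type*} (c : ℝ) (e : ι → Matrix n n ℂ) (U : Bd → Matrix n n ℂ) (b : Bd) (k i : ι) :
    adMat c e (U b) k i = compMat c e U b k i := rfl

/-- **`adMat u⁻¹ = (adMat u)ᵀ`** (pv27 `compMat_inv`: the `form`-adjoint of `R(u)` is `R(u⁻¹)`).
[cite: Balaban1985BackgroundPropagators, (3.8) p.392 + (3.5) p.391] -/
theorem adMat_inv (c : ℝ) (e : ι → Matrix n n ℂ) {u : Matrix n n ℂ} (hu : IsUnit u.det) :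
    adMat c e u⁻¹ = (adMat c e u)ᵀ := by
  ext k i
  rw [Matrix.transpose_apply]
  exact compMat_inv c e (fun _ : Unit => u) (fun _ => hu) () k i

/-- The same for a unitary `u`, `u⁻¹ = u⋆`. [folklore] -/
theorem adMat_star (c : ℝ) (e : ι → Matrix n n ℂ) {u : Matrix n n ℂ} (hu : u ∈ Matrix.unitaryGroup n ℂ) :
    adMat c e (star u) = (adMat c e u)ᵀ := by
  rw [← inv_eq_star_of_mem hu]
  exact adMat_inv c e (isUnit_det_of_mem_unitaryGroup hu)

end Def

section Algebra

variable [Fintype ι] (c : ℝ) (P : Submodule ℝ (Matrix n n ℂ)) (e : ι → Matrix n n ℂ)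
  (he : ∀ k, e k ∈ P) (hcompl : ∀ X ∈ P, ∑ k, form c (e k) X • e k = X)
  (hP : ∀ u ∈ Matrix.unitaryGroup n ℂ, ∀ X ∈ P, R u X ∈ P)

include he hcompl hP in
/-- **MULTIPLICATIVITY** `adMat (u·w) = adMat u · adMat w` for unitary `w` (completeness of `e` on the `R(w)`-stable
subspace `P`; `R(u)R(w) = R(uw)`). [cite: Balaban1985Averaging, (57) p.27] -/
theorem adMat_mul (u : Matrix n n ℂ) {w : Matrix n n ℂ} (hw : w ∈ Matrix.unitaryGroup n ℂ) :
    adMat c e (u * w) = adMat c e u * adMat c e w := by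
  ext k i
  rw [Matrix.mul_apply, adMat_apply, ← R_R]
  have h := coord_map (form c) P e hcompl (Rₗ u) (hP w hw (e i) (he i)) k
  simpa only [Rₗ_apply, adMat_apply] using h

variable [DecidableEq ι] (horth : ∀ k l, form c (e k) (e l) = if k = l then (1 : ℝ) else 0)

omit [Fintype ι] in
include horth in
/-- `adMat 1 = 1` (orthonormality). [folklore] -/
theorem adMat_one : adMat c e (1 : Matrix n n ℂ) = 1 := by
  ext k i
  rw [adMat_apply, R, inv_one, Matrix.mul_one, Matrix.one_mul, horth, Matrix.one_apply]

include he horth hcompl hP in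
/-- **ORTHOGONALITY** `(adMat u)ᵀ · adMat u = 1` for unitary `u` (pv27 `compMat_orthogonal` BY NAME).
[cite: Balaban1985BackgroundPropagators, p.392] -/
theorem adMat_transpose_mul_self {u : Matrix n n ℂ} (hu : u ∈ Matrix.unitaryGroup n ℂ) :
    (adMat c e u)ᵀ * adMat c e u = 1 := by
  ext i j
  rw [Matrix.mul_apply, Matrix.one_apply]
  simp only [Matrix.transpose_apply]
  exact compMat_orthogonal c P e he horth hcompl (fun _ : Unit => u) (fun _ => isUnit_det_of_mem_unitaryGroup hu)
    (fun _ X hX => hP u hu X hX) () i j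

include he horth hcompl hP in
/-- `adMat u · (adMat u)ᵀ = 1` as well (square matrices). [folklore] -/
theorem adMat_mul_transpose_self {u : Matrix n n ℂ} (hu : u ∈ Matrix.unitaryGroup n ℂ) :
    adMat c e u * (adMat c e u)ᵀ = 1 :=
  mul_eq_one_comm.mp (adMat_transpose_mul_self c P e he hcompl hP horth hu)

end Algebra

/-! ## §2 Hilbert–Schmidt bookkeeping and the bound on `R(u)X − X` -/

section Frobenius

/-- The Hilbert–Schmidt square `Σ_{a,b} |M_{ab}|²` (kept as a plain sum: the cell's matrix norm is the `ℓ²`-operator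
norm, not Frobenius). [folklore] -/
def fro (M : Matrix n n ℂ) : ℝ := ∑ a, ∑ b, ‖M a b‖ ^ 2

omit [DecidableEq n] in
/-- `fro ≥ 0`. [folklore] -/
theorem fro_nonneg (M : Matrix n n ℂ) : 0 ≤ fro M := sum_nonneg fun _ _ => sum_nonneg fun _ _ => sq_nonneg _

omit [DecidableEq n] in
/-- `fro M = Re tr(M Mᴴ)`. [folklore] -/
theorem fro_eq_re_trace (M : Matrix n n ℂ) : fro M = (Matrix.trace (M * Mᴴ)).re := by
  rw [Matrix.trace, Complex.re_sum, fro]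
  refine Finset.sum_congr rfl fun a _ => ?_
  rw [Matrix.diag_apply, Matrix.mul_apply, Complex.re_sum]
  refine Finset.sum_congr rfl fun b _ => ?_
  rw [Matrix.conjTranspose_apply, Complex.star_def, Complex.mul_conj, Complex.ofReal_re, Complex.normSq_eq_norm_sq]

omit [DecidableEq n] in
/-- `fro Mᴴ = fro M`. [folklore] -/
theorem fro_conjTranspose (M : Matrix n n ℂ) : fro Mᴴ = fro M := by
  rw [fro, fro, Finset.sum_comm]
  refine Finset.sum_congr rfl fun a _ => Finset.sum_congr rfl fun b _ => ?_
  rw [Matrix.conjTranspose_apply, Complex.star_def, Complex.norm_conj]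

/-- Right multiplication by `w` with `w wᴴ = 1` preserves `fro`. [folklore] -/
theorem fro_mul_of_mul_conjTranspose {w : Matrix n n ℂ} (hw : w * wᴴ = 1) (M : Matrix n n ℂ) :
    fro (M * w) = fro M := by
  rw [fro_eq_re_trace, fro_eq_re_trace, Matrix.conjTranspose_mul, Matrix.mul_assoc, ← Matrix.mul_assoc w, hw,
    Matrix.one_mul]

omit [DecidableEq n] in
/-- `fro (S + T) ≤ 2 fro S + 2 fro T`. [folklore] -/
theorem fro_add_le (S T : Matrix n n ℂ) : fro (S + T) ≤ 2 * fro S + 2 * fro T := by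
  rw [fro, fro, fro, Finset.mul_sum, Finset.mul_sum, ← Finset.sum_add_distrib]
  refine Finset.sum_le_sum fun a _ => ?_
  rw [Finset.mul_sum, Finset.mul_sum, ← Finset.sum_add_distrib]
  refine Finset.sum_le_sum fun b _ => ?_
  rw [Matrix.add_apply]
  have h := norm_add_le (S a b) (T a b)
  nlinarith [sq_nonneg (‖S a b‖ - ‖T a b‖), norm_nonneg (S a b + T a b), norm_nonneg (S a b), norm_nonneg (T a b)]

/-- One column: `Σ_a |(A M)_{ab}|² ≤ ‖A‖²·Σ_a |M_{ab}|²` (`‖·‖` the `ℓ²`-operator norm). [folklore] -/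
theorem col_sq_le (A M : Matrix n n ℂ) (b : n) : ∑ a, ‖(A * M) a b‖ ^ 2 ≤ ‖A‖ ^ 2 * ∑ a, ‖M a b‖ ^ 2 := by
  have h := norm_toLp_mulVec_le A (fun a => M a b)
  have h1 : ‖(WithLp.toLp 2 (A *ᵥ fun a => M a b) : EuclideanSpace ℂ n)‖ ^ 2 = ∑ a, ‖(A * M) a b‖ ^ 2 := by
    rw [EuclideanSpace.norm_sq_eq]
    refine Finset.sum_congr rfl fun a _ => ?_
    rw [PiLp.toLp_apply, Matrix.mulVec, dotProduct, Matrix.mul_apply]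
  have h2 : ‖(WithLp.toLp 2 (fun a => M a b) : EuclideanSpace ℂ n)‖ ^ 2 = ∑ a, ‖M a b‖ ^ 2 := by
    rw [EuclideanSpace.norm_sq_eq]
  rw [← h1, ← h2, ← mul_pow]
  exact pow_le_pow_left₀ (norm_nonneg _) h 2

/-- Left multiplication: `fro (A M) ≤ ‖A‖²·fro M`. [folklore] -/
theorem fro_mul_le (A M : Matrix n n ℂ) : fro (A * M) ≤ ‖A‖ ^ 2 * fro M := by
  calc fro (A * M) = ∑ b, ∑ a, ‖(A * M) a b‖ ^ 2 := by rw [fro, Finset.sum_comm]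
    _ ≤ ∑ b, ‖A‖ ^ 2 * ∑ a, ‖M a b‖ ^ 2 := Finset.sum_le_sum fun b _ => col_sq_le A M b
    _ = ‖A‖ ^ 2 * ∑ b, ∑ a, ‖M a b‖ ^ 2 := by rw [Finset.mul_sum]
    _ = ‖A‖ ^ 2 * fro M := by rw [fro, Finset.sum_comm]

/-- **THE BOUND ON `R(u)X − X`**: for unitary `u` and any `X`, `fro (uXu⁻¹ − X) ≤ 4‖u − 1‖²·fro X` — from
`uXu⋆ − X = (u − 1)·(Xu⋆) + X·(u⋆ − 1)`, `(X(u⋆−1))ᴴ = (u−1)Xᴴ`, and the three bookkeeping facts above. [folklore] -/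
theorem fro_R_sub_le {u : Matrix n n ℂ} (hu : u ∈ Matrix.unitaryGroup n ℂ) (X : Matrix n n ℂ) :
    fro (R u X - X) ≤ 4 * ‖u - 1‖ ^ 2 * fro X := by
  have hsu : star u * u = 1 := Matrix.mem_unitaryGroup_iff'.mp hu
  have hR : R u X - X = (u - 1) * (X * star u) + X * (star u - 1) := by
    rw [R, inv_eq_star_of_mem hu]
    noncomm_ring
  have hw : star u * (star u)ᴴ = 1 := by
    rw [Matrix.star_eq_conjTranspose, Matrix.conjTranspose_conjTranspose]
    simpa only [Matrix.star_eq_conjTranspose] using hsu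
  have h1 : fro ((u - 1) * (X * star u)) ≤ ‖u - 1‖ ^ 2 * fro X := by
    refine (fro_mul_le _ _).trans (le_of_eq ?_)
    rw [fro_mul_of_mul_conjTranspose hw]
  have h2 : fro (X * (star u - 1)) ≤ ‖u - 1‖ ^ 2 * fro X := by
    have hct : (X * (star u - 1))ᴴ = (u - 1) * Xᴴ := by
      rw [Matrix.conjTranspose_mul, Matrix.conjTranspose_sub, Matrix.conjTranspose_one, Matrix.star_eq_conjTranspose,
        Matrix.conjTranspose_conjTranspose]
    rw [← fro_conjTranspose, hct]
    refine (fro_mul_le _ _).trans (le_of_eq ?_)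
    rw [fro_conjTranspose]
  rw [hR]
  refine (fro_add_le _ _).trans ?_
  nlinarith [h1, h2, fro_nonneg X, sq_nonneg ‖u - 1‖]

omit [DecidableEq n] in
/-- On a hermitian matrix the trace form is `c·fro`: `form c X X = c·Σ|X_{ab}|²`. [folklore] -/
theorem form_self_eq_fro {c : ℝ} {X : Matrix n n ℂ} (hX : X.IsHermitian) : form c X X = c * fro X := by
  rw [form_apply, fro_eq_re_trace, hX.eq]

end Frobenius

/-! ## §3 The Lipschitz bound `‖cpx(adMat u) − 1‖ ≤ 2‖u − 1‖` -/

section Lipschitz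

variable [Fintype ι] [DecidableEq ι] {c : ℝ} (hc : 0 < c) (P : Submodule ℝ (Matrix n n ℂ))
  (hPh : ∀ X ∈ P, X.IsHermitian) (e : ι → Matrix n n ℂ) (he : ∀ k, e k ∈ P)
  (horth : ∀ k l, form c (e k) (e l) = if k = l then (1 : ℝ) else 0)
  (hcompl : ∀ X ∈ P, ∑ k, form c (e k) X • e k = X) (hP : ∀ u ∈ Matrix.unitaryGroup n ℂ, ∀ X ∈ P, R u X ∈ P)

omit [DecidableEq n] in
include horth in
/-- Coordinates of a combination: `form c (e k) (Σ_i a_i e_i) = a_k`. [folklore] -/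
theorem form_combination (a : ι → ℝ) (k : ι) : form c (e k) (∑ i, a i • e i) = a k := by
  rw [map_sum]
  simp_rw [map_smul, smul_eq_mul, horth]
  simp

include hc hPh he horth hcompl hP in
/-- **THE REAL COMPONENT BOUND**: for unitary `u` and a REAL coefficient vector `a`,
`Σ_k (Σ_i ((adMat u)_{ki} − δ_{ki}) a_i)² ≤ 4‖u − 1‖²·Σ_k a_k²` (Parseval on `P` for `X = Σ a_i e_i` and `R(u)X − X`,
then `fro_R_sub_le`). [folklore] -/
theorem adMat_real_bound {u : Matrix n n ℂ} (hu : u ∈ Matrix.unitaryGroup n ℂ) (a : ι → ℝ) :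
    ∑ k, (∑ i, (adMat c e u - 1) k i * a i) ^ 2 ≤ 4 * ‖u - 1‖ ^ 2 * ∑ k, a k ^ 2 := by
  set X : Matrix n n ℂ := ∑ i, a i • e i with hXdef
  have hX : X ∈ P := P.sum_mem fun i _ => P.smul_mem _ (he i)
  set Y : Matrix n n ℂ := R u X - X with hYdef
  have hY : Y ∈ P := P.sub_mem (hP u hu X hX) hX
  -- the components of `Y` are the entries of `((adMat u) − 1) a`
  have hcoef : ∀ k, ∑ i, (adMat c e u - 1) k i * a i = form c (e k) Y := by
    intro k
    have hL : ∑ i, (adMat c e u - 1) k i * a i = ∑ i, form c (e k) (R u (e i)) * a i - a k := by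
      simp_rw [Matrix.sub_apply, adMat_apply, Matrix.one_apply, sub_mul, Finset.sum_sub_distrib]
      congr 1
      simp [ite_mul]
    have hR' : form c (e k) Y = ∑ i, form c (e k) (R u (e i)) * a i - a k := by
      rw [hYdef, map_sub, hXdef, R_sum_smul, map_sum, form_combination e horth a k]
      congr 1
      refine Finset.sum_congr rfl fun i _ => ?_
      rw [map_smul, smul_eq_mul, mul_comm]
    rw [hL, hR']
  -- Parseval twice
  have hPY : ∑ k, form c (e k) Y ^ 2 = form c Y Y := by
    simp_rw [sq]; exact parseval (form c) e (hcompl Y hY) Y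
  have hPX : ∑ k, form c (e k) X ^ 2 = form c X X := by
    simp_rw [sq]; exact parseval (form c) e (hcompl X hX) X
  have hak2 : ∑ k, a k ^ 2 = ∑ k, form c (e k) X ^ 2 :=
    Finset.sum_congr rfl fun k _ => by rw [hXdef, form_combination e horth a k]
  calc ∑ k, (∑ i, (adMat c e u - 1) k i * a i) ^ 2 = ∑ k, form c (e k) Y ^ 2 :=
        Finset.sum_congr rfl fun k _ => by rw [hcoef k]
    _ = c * fro Y := by rw [hPY, form_self_eq_fro (hPh Y hY)]
    _ ≤ c * (4 * ‖u - 1‖ ^ 2 * fro X) := mul_le_mul_of_nonneg_left (fro_R_sub_le hu X) hc.le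
    _ = 4 * ‖u - 1‖ ^ 2 * form c X X := by rw [form_self_eq_fro (hPh X hX)]; ring
    _ = 4 * ‖u - 1‖ ^ 2 * ∑ k, a k ^ 2 := by rw [← hPX, hak2]

include hc hPh he horth hcompl hP in
/-- **THE LIPSCHITZ BOUND** `‖cpx(adMat c e u) − 1‖ ≤ 2·‖u − 1‖` for unitary `u` (`ℓ²`-operator norms): split a complex
fibre vector into real and imaginary parts, apply `adMat_real_bound` to each. [folklore] -/
theorem norm_cpx_adMat_sub_one_le {u : Matrix n n ℂ} (hu : u ∈ Matrix.unitaryGroup n ℂ) :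
    ‖cpxHom (adMat c e u) - 1‖ ≤ 2 * ‖u - 1‖ := by
  have hA : cpxHom (adMat c e u) - 1 = cpxHom (adMat c e u - 1) := by rw [map_sub, map_one]
  rw [hA]
  refine norm_le_of_mulVec_le _ (by positivity) fun v => ?_
  -- real and imaginary parts
  have hre : ∀ k, ((cpxHom (adMat c e u - 1) *ᵥ v) k).re = ∑ i, (adMat c e u - 1) k i * (v i).re := by
    intro k
    simp only [Matrix.mulVec, dotProduct, cpxHom_apply, Complex.re_sum, Complex.re_ofReal_mul]
  have him : ∀ k, ((cpxHom (adMat c e u - 1) *ᵥ v) k).im = ∑ i, (adMat c e u - 1) k i * (v i).im := by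
    intro k
    simp only [Matrix.mulVec, dotProduct, cpxHom_apply, Complex.im_sum, Complex.im_ofReal_mul]
  have hsq : ‖(WithLp.toLp 2 (cpxHom (adMat c e u - 1) *ᵥ v) : EuclideanSpace ℂ ι)‖ ^ 2 =
      ∑ k, (∑ i, (adMat c e u - 1) k i * (v i).re) ^ 2 + ∑ k, (∑ i, (adMat c e u - 1) k i * (v i).im) ^ 2 := by
    rw [EuclideanSpace.norm_sq_eq, ← Finset.sum_add_distrib]
    refine Finset.sum_congr rfl fun k _ => ?_
    rw [PiLp.toLp_apply, Complex.sq_norm, Complex.normSq_apply, hre, him]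
    ring
  have hv : ‖(WithLp.toLp 2 v : EuclideanSpace ℂ ι)‖ ^ 2 = ∑ k, (v k).re ^ 2 + ∑ k, (v k).im ^ 2 := by
    rw [EuclideanSpace.norm_sq_eq, ← Finset.sum_add_distrib]
    refine Finset.sum_congr rfl fun k _ => ?_
    rw [PiLp.toLp_apply, Complex.sq_norm, Complex.normSq_apply]
    ring
  have h1 := adMat_real_bound hc P hPh e he horth hcompl hP hu (fun i => (v i).re)
  have h2 := adMat_real_bound hc P hPh e he horth hcompl hP hu (fun i => (v i).im)
  have hsq_le : ‖(WithLp.toLp 2 (cpxHom (adMat c e u - 1) *ᵥ v) : EuclideanSpace ℂ ι)‖ ^ 2 ≤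
      (2 * ‖u - 1‖ * ‖(WithLp.toLp 2 v : EuclideanSpace ℂ ι)‖) ^ 2 := by
    rw [hsq, mul_pow, mul_pow, hv]
    nlinarith [h1, h2]
  exact (pow_le_pow_iff_left₀ (norm_nonneg _) (by positivity) two_ne_zero).mp hsq_le

end Lipschitz

/-! ## §4 Non-vacuity: `su(2)` in the Pauli components -/

/-- Every hypothesis of `norm_cpx_adMat_sub_one_le` is inhabited: `N = 2`, `c = ½`, `P = herm0 (Fin 2)` (= su(2) in the
hermitian convention), `e = pauli` (pv27: hermitian, traceless, `form ½`-orthonormal, complete), `R(U(2))`-stability by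
`R_mem_herm0`, and the unitary `u = σ₁`: the Lipschitz bound `‖cpx(adMat ½ pauli σ₁) − 1‖ ≤ 2‖σ₁ − 1‖` fires. [folklore] -/
example : ‖cpxHom (adMat (1 / 2 : ℝ) pauli σ₁) - 1‖ ≤ 2 * ‖σ₁ - 1‖ :=
  norm_cpx_adMat_sub_one_le (by norm_num) (herm0 (Fin 2)) (fun _ hX => hX.1) pauli
    (fun k => ⟨pauli_isHermitian k, pauli_trace k⟩) pauli_orth (fun X hX => pauli_complete X hX.1 hX.2)
    (fun _ hu _ hX => R_mem_herm0 hu hX) σ₁_mem_unitaryGroup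

end

end Summit.QuantumFields.BalabanUV.Beta.AdjointCarrierWiring
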